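import Literature.NumberTheory.QuadraticForms.HermitianDefiniteRealisation
import Literature.NumberTheory.QuadraticForms.LandherrHermitianRealisation
import HarnessLib

/-!
# A global `⋆`-symmetric unit of `Z(γ₀)` with PRESCRIBED block signatures (Rogawski 1990, §3.8 Prop. 3.8.1 (d); Landherr 1936)

Namespace `Literature.NumberTheory.Rogawski1990`; **THEOREMS ONLY** (no definition, no named fact, no instance, no notation, no `sorry`).
Cell `pub/hodgecm-mathlib`, ENGINE T1 (crux H413 = `stmt-HodgeConjecture-24833`), O7 «singular semisimple classes», piece **(R6a-s′)** of the
`hreal` assembly for ★ `singularObs` (O7 OWNER RULE 2026-08-31 10:06Z «(F2) only `hanis`: `Y_a` of PRESCRIBED signature per real place»): the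
prescribed-signature edition of ★ `exists_commute_hermStar_eq_of_frame` (★ `QuadraticForms.HermitianDefiniteRealisation`, which is the totally
positive `ξ` ∕ same-signature case).

THE MATHEMATICS.  `H ∈ M₃(L)` hermitian non-degenerate over the CM field `L` (`σ` = complex conjugation, `L⁺` its fixed field), `γ₀ ∈ M₃(L)` with
a plane-first singular frame `P ∈ GL₃(L)`: `ᵗ(σP) H P = H_a ⊕ᶠ H_b` (`H_a ∈ M₂(L)`, `H_b ∈ M₁(L)` hermitian non-degenerate), `γ₀ P = P (a·1₂ ⊕ᶠ b·1₁)`.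
* §1 (blocks given).  For ANY hermitian `Y_a ∈ M₂(L)`, `Y_b ∈ M₁(L)` with `det Y_a · det Y_b = det H_a · det H_b`, the element
  `y := P (H_a⁻¹ Y_a ⊕ᶠ H_b⁻¹ Y_b) P⁻¹` commutes with `γ₀`, is `⋆`-symmetric (`y⋆ := H⁻¹ ᵗ(σy) H = y`), has `det y = 1`, and `ᵗ(σP) (H y) P = Y_a ⊕ᶠ Y_b`.
* §2 (prescribed signature — Landherr's realisation of invariants, ★ `Landherr.exists_hermitianDiagonal_of_invariants`).  For `ξ ∈ L⁺ˣ` and a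
  prescribed positive index `p w ≤ 2` at every infinite place `w` of `L` satisfying the parity condition `sign_w(ξ · det H_a) = (−1)^{2 − p w}`,
  there is such a pair with `Y_a` of positive index EXACTLY `p w` at every `w`, `det Y_a = ξ · det H_a`, and `Y_b = ξ⁻¹ H_b` — the global
  representative of the `Z(γ₀) ≅ GL₂ × GL₁`-class with block determinant classes `(ξ, ξ⁻¹)` AND prescribed archimedean block signatures that
  Kottwitz's criterion at a SINGULAR semisimple `γ₀` compares the adelic class `x_g` with (Prop. 3.8.1 (d): `|𝓡| = 2`, the archimedean half of
  the obstruction being the signature of the `a`-block at the indefinite places).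
* §3 the `1 × 1` reading: the positive index of a `1 × 1` complex hermitian matrix is `[0 < M₀₀]`.

HONEST LABEL: global algebra over `L` only (no adèles, no places beyond the complex embeddings `τ : L →+* ℂ`); the consumer is the trunk's (h5)
`hreal_singularObs`, which feeds `p w :=` the positive index of the `a`-block of `H_{g,w}` and discharges the parity by the sign reading (h4′)∕(h3′).
HC_CM is proved only modulo the printed citations until rung 0 closes.

## References
* [Rogawski1990] J. D. Rogawski, *Automorphic Representations of Unitary Groups in Three Variables*, Ann. of Math. Stud. 123 (1990), §3.3
  Prop. 3.3.1 p. 22; §3.8 Prop. 3.8.1 (a)(d) p. 27.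
* [Landherr1936HermitianForms] W. Landherr, *Äquivalenz Hermitescher Formen über einem beliebigen algebraischen Zahlkörper*, Abh. Math. Sem.
  Hamburg 11 (1936) 245–248 (local–global classification; realisation of invariants).
* [Deligne1982HodgeCycles] P. Deligne, *Hodge cycles on abelian varieties*, LNM 900 (1982), §4 Prop. 4.1 p. 44 (realisation of hermitian invariants).
-/

set_option autoImplicit false

noncomputable section

open NumberField
open scoped Matrix MatrixGroups

namespace Literature.NumberTheory.Rogawski1990

open Literature.NumberTheory.QuadraticForms
open Literature.NumberTheory.Automorphic
open Literature.NumberTheory.Automorphic.UnitaryGroup (finSum finSum_map)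

/-! ### §0 Block algebra over `⊕ᶠ` (private copies of the tree's `finSum` plumbing) -/

section Blocks

variable {S : Type*} [CommRing S] {N₁ N₂ : ℕ}

/-- `(A ⊕ᶠ B)(C ⊕ᶠ D) = AC ⊕ᶠ BD`. [folklore] -/
private theorem finSum_mul_finSum₃ (A C : Matrix (Fin N₁) (Fin N₁) S) (B D : Matrix (Fin N₂) (Fin N₂) S) :
    finSum N₁ N₂ A B * finSum N₁ N₂ C D = finSum N₁ N₂ (A * C) (B * D) := by
  simp only [finSum, Matrix.reindex_apply, Matrix.submatrix_mul_equiv, Matrix.fromBlocks_multiply, Matrix.mul_zero, Matrix.zero_mul,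
    add_zero, zero_add]

/-- `ᵗ(σ(A ⊕ᶠ B)) = ᵗ(σA) ⊕ᶠ ᵗ(σB)`. [folklore] -/
private theorem finSum_conjTranspose₃ (σ : S →+* S) (A : Matrix (Fin N₁) (Fin N₁) S) (B : Matrix (Fin N₂) (Fin N₂) S) :
    ((finSum N₁ N₂ A B).map σ)ᵀ = finSum N₁ N₂ ((A.map σ)ᵀ) ((B.map σ)ᵀ) := by
  rw [finSum_map]
  simp only [finSum, Matrix.reindex_apply, Matrix.transpose_submatrix, Matrix.fromBlocks_transpose, Matrix.transpose_zero]

/-- `det (A ⊕ᶠ B) = det A · det B`. [folklore] -/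
private theorem det_finSum₃ (A : Matrix (Fin N₁) (Fin N₁) S) (B : Matrix (Fin N₂) (Fin N₂) S) : (finSum N₁ N₂ A B).det = A.det * B.det := by
  rw [finSum, Matrix.det_reindex_self, Matrix.det_fromBlocks_zero₂₁]

/-- Block scalars commute with block-diagonal matrices: `(A ⊕ᶠ B)(a·1 ⊕ᶠ b·1) = (a·1 ⊕ᶠ b·1)(A ⊕ᶠ B)`. [folklore] -/
private theorem finSum_mul_finSum_smul_one_comm₃ (A : Matrix (Fin N₁) (Fin N₁) S) (B : Matrix (Fin N₂) (Fin N₂) S) (a b : S) :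
    finSum N₁ N₂ A B * finSum N₁ N₂ (a • (1 : Matrix (Fin N₁) (Fin N₁) S)) (b • (1 : Matrix (Fin N₂) (Fin N₂) S)) =
      finSum N₁ N₂ (a • (1 : Matrix (Fin N₁) (Fin N₁) S)) (b • (1 : Matrix (Fin N₂) (Fin N₂) S)) * finSum N₁ N₂ A B := by
  rw [finSum_mul_finSum₃, finSum_mul_finSum₃, Matrix.mul_smul, Matrix.mul_one, Matrix.mul_smul, Matrix.mul_one, Matrix.smul_mul,
    Matrix.one_mul, Matrix.smul_mul, Matrix.one_mul]

end Blocks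

section Frame

variable {L : Type} [Field L] [NumberField L] [IsCMField L]

/-! ### §1 Blocks given: `y := P (H_a⁻¹ Y_a ⊕ᶠ H_b⁻¹ Y_b) P⁻¹` is a `⋆`-symmetric unit of `Z(γ₀)` with `ᵗ(σP) (H y) P = Y_a ⊕ᶠ Y_b` -/

/-- **A `⋆`-SYMMETRIC UNIT OF `Z(γ₀)` WITH GIVEN HERMITIAN BLOCKS (singular plane-first frame).**  `H ∈ M₃(L)` hermitian non-degenerate, `γ₀` framed
by `P`: `ᵗ(σP) H P = H_a ⊕ᶠ H_b`, `γ₀ P = P (a·1₂ ⊕ᶠ b·1₁)`; for hermitian `Y_a ∈ M₂(L)`, `Y_b ∈ M₁(L)` with `det Y_a · det Y_b = det H_a · det H_b` the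
element `y := P (H_a⁻¹Y_a ⊕ᶠ H_b⁻¹Y_b) P⁻¹` satisfies `y γ₀ = γ₀ y`, `y⋆ = y`, `det y = 1`, `ᵗ(σP) (H·y) P = Y_a ⊕ᶠ Y_b`.
[cite: Rogawski1990, §3.8 Prop. 3.8.1 (a)(d) p. 27; §3.3 Prop. 3.3.1 p. 22] -/
theorem exists_commute_hermStar_eq_of_frame_blocks {H : Matrix (Fin 3) (Fin 3) L} (hH : (H.map (cmConjRingHom L))ᵀ = H) (h0 : H.det ≠ 0)
    (γ₀ : Matrix (Fin 3) (Fin 3) L) {a b : L} {P : GL (Fin 3) L} {Ha : Matrix (Fin 2) (Fin 2) L} {Hb : Matrix (Fin 1) (Fin 1) L}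
    (hP : (((P : Matrix (Fin 3) (Fin 3) L)).map (cmConjRingHom L))ᵀ * H * (P : Matrix (Fin 3) (Fin 3) L) = finSum 2 1 Ha Hb)
    (hγP : γ₀ * (P : Matrix (Fin 3) (Fin 3) L) =
      (P : Matrix (Fin 3) (Fin 3) L) * finSum 2 1 (a • (1 : Matrix (Fin 2) (Fin 2) L)) (b • (1 : Matrix (Fin 1) (Fin 1) L)))
    (hda : Ha.det ≠ 0) (hdb : Hb.det ≠ 0) {Ya : Matrix (Fin 2) (Fin 2) L} {Yb : Matrix (Fin 1) (Fin 1) L}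
    (hYa : (Ya.map (cmConjRingHom L))ᵀ = Ya) (hYb : (Yb.map (cmConjRingHom L))ᵀ = Yb) (hdet : Ya.det * Yb.det = Ha.det * Hb.det) :
    ∃ y : Matrix (Fin 3) (Fin 3) L,
      y = (P : Matrix (Fin 3) (Fin 3) L) * finSum 2 1 (Ha⁻¹ * Ya) (Hb⁻¹ * Yb) * ((P⁻¹ : GL (Fin 3) L) : Matrix (Fin 3) (Fin 3) L) ∧
      Commute y γ₀ ∧ hermStar (cmConjRingHom L) H y = y ∧ y.det = 1 ∧
      (((P : Matrix (Fin 3) (Fin 3) L)).map (cmConjRingHom L))ᵀ * (H * y) * (P : Matrix (Fin 3) (Fin 3) L) = finSum 2 1 Ya Yb := by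
  set Q : Matrix (Fin 3) (Fin 3) L := (P : Matrix (Fin 3) (Fin 3) L) with hQ
  set Qs : Matrix (Fin 3) (Fin 3) L := (Q.map (cmConjRingHom L))ᵀ with hQs
  set S : Matrix (Fin 3) (Fin 3) L := finSum 2 1 Ha Hb with hS
  set T : Matrix (Fin 3) (Fin 3) L := finSum 2 1 Ya Yb with hT
  set M : Matrix (Fin 3) (Fin 3) L := finSum 2 1 (Ha⁻¹ * Ya) (Hb⁻¹ * Yb) with hM
  set y : Matrix (Fin 3) (Fin 3) L := Q * M * ((P⁻¹ : GL (Fin 3) L) : Matrix (Fin 3) (Fin 3) L) with hy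
  have hPP : Q * ((P⁻¹ : GL (Fin 3) L) : Matrix (Fin 3) (Fin 3) L) = 1 := P.mul_inv
  have hPP' : ((P⁻¹ : GL (Fin 3) L) : Matrix (Fin 3) (Fin 3) L) * Q = 1 := P.inv_mul
  have hSM : S * M = T := by
    rw [hS, hM, hT, finSum_mul_finSum₃, ← Matrix.mul_assoc, ← Matrix.mul_assoc, Matrix.mul_nonsing_inv Ha (Ne.isUnit hda),
      Matrix.mul_nonsing_inv Hb (Ne.isUnit hdb), Matrix.one_mul, Matrix.one_mul]
  -- the frame identity for `H · y`
  have hframe : Qs * (H * y) * Q = T := by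
    have h1 : Qs * (H * y) * Q = Qs * H * Q * M * (((P⁻¹ : GL (Fin 3) L) : Matrix (Fin 3) (Fin 3) L) * Q) := by
      rw [hy]; simp only [Matrix.mul_assoc]
    rw [h1, hPP', Matrix.mul_one, hP, hSM]
  have hT_herm : (T.map (cmConjRingHom L))ᵀ = T := by
    rw [hT, finSum_conjTranspose₃, hYa, hYb]
  -- `H · y` is hermitian (its frame congruent `T` is), hence `y⋆ = y`
  have hHy_herm : ((H * y).map (cmConjRingHom L))ᵀ = H * y := by
    refine hermitian_of_congr_hermitian P ?_
    rw [← hQ, ← hQs, hframe, hT_herm]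
  have hstar : hermStar (cmConjRingHom L) H y = y := hermStar_eq_self_of_mul_hermitian hH (Ne.isUnit h0) hHy_herm
  -- `y` commutes with `γ₀ = P (a·1 ⊕ᶠ b·1) P⁻¹`
  have hγ : γ₀ = Q * finSum 2 1 (a • (1 : Matrix (Fin 2) (Fin 2) L)) (b • (1 : Matrix (Fin 1) (Fin 1) L)) *
      ((P⁻¹ : GL (Fin 3) L) : Matrix (Fin 3) (Fin 3) L) := by
    rw [← hγP, Matrix.mul_assoc, hPP, Matrix.mul_one]
  have hcomm : Commute y γ₀ := by
    rw [Commute, SemiconjBy, hγ, hy]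
    calc Q * M * ((P⁻¹ : GL (Fin 3) L) : Matrix (Fin 3) (Fin 3) L) *
          (Q * finSum 2 1 (a • (1 : Matrix (Fin 2) (Fin 2) L)) (b • (1 : Matrix (Fin 1) (Fin 1) L)) * ((P⁻¹ : GL (Fin 3) L) : Matrix (Fin 3) (Fin 3) L))
        = Q * (M * ((((P⁻¹ : GL (Fin 3) L) : Matrix (Fin 3) (Fin 3) L) * Q) *
            finSum 2 1 (a • (1 : Matrix (Fin 2) (Fin 2) L)) (b • (1 : Matrix (Fin 1) (Fin 1) L)))) * ((P⁻¹ : GL (Fin 3) L) : Matrix (Fin 3) (Fin 3) L) := by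
          simp only [Matrix.mul_assoc]
      _ = Q * (finSum 2 1 (a • (1 : Matrix (Fin 2) (Fin 2) L)) (b • (1 : Matrix (Fin 1) (Fin 1) L)) *
            ((((P⁻¹ : GL (Fin 3) L) : Matrix (Fin 3) (Fin 3) L) * Q) * M)) * ((P⁻¹ : GL (Fin 3) L) : Matrix (Fin 3) (Fin 3) L) := by
          rw [hPP', Matrix.one_mul, Matrix.one_mul, hM, finSum_mul_finSum_smul_one_comm₃]
      _ = Q * finSum 2 1 (a • (1 : Matrix (Fin 2) (Fin 2) L)) (b • (1 : Matrix (Fin 1) (Fin 1) L)) * ((P⁻¹ : GL (Fin 3) L) : Matrix (Fin 3) (Fin 3) L) *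
            (Q * M * ((P⁻¹ : GL (Fin 3) L) : Matrix (Fin 3) (Fin 3) L)) := by
          simp only [Matrix.mul_assoc]
  -- `det y = 1`
  have hdet1 : y.det = 1 := by
    have hM1 : M.det = 1 := by
      rw [hM, det_finSum₃, Matrix.det_mul, Matrix.det_mul, Matrix.det_nonsing_inv, Matrix.det_nonsing_inv,
        Ring.inverse_eq_inv Ha.det, Ring.inverse_eq_inv Hb.det]
      calc Ha.det⁻¹ * Ya.det * (Hb.det⁻¹ * Yb.det) = (Ha.det * Hb.det)⁻¹ * (Ya.det * Yb.det) := by rw [mul_inv]; ring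
        _ = 1 := by rw [hdet, inv_mul_cancel₀ (mul_ne_zero hda hdb)]
    rw [hy, hQ, Matrix.det_units_conj, hM1]
  exact ⟨y, hy, hcomm, hstar, hdet1, hframe⟩

/-! ### §2 Prescribed signature: Landherr's realisation of invariants on the `a`-block -/

/-- A diagonal matrix with `σ`-fixed entries is hermitian. [folklore] -/
private theorem transpose_map_diagonal_of_isReal {ι : Type} [Fintype ι] [DecidableEq ι] {d : ι → L}
    (hd : ∀ i, IsCMField.complexConj L (d i) = d i) : ((Matrix.diagonal d).map (cmConjRingHom L))ᵀ = Matrix.diagonal d := by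
  rw [Matrix.diagonal_map (map_zero _), Matrix.diagonal_transpose]
  exact congrArg Matrix.diagonal (funext fun i => hd i)

/-- **(R6a-s′) A GLOBAL `⋆`-SYMMETRIC UNIT OF `Z(γ₀)` WITH PRESCRIBED BLOCK DETERMINANT CLASSES AND PRESCRIBED `a`-BLOCK SIGNATURES.**  `H ∈ M₃(L)`
hermitian non-degenerate over the CM field `L`, `γ₀` with a plane-first singular frame `P` (`ᵗ(σP) H P = H_a ⊕ᶠ H_b`, `γ₀ P = P (a·1₂ ⊕ᶠ b·1₁)`,
`H_a`, `H_b` hermitian non-degenerate).  Let `ξ ∈ L⁺ˣ` and `p : InfinitePlace L → ℕ`, `p w ≤ 2`, satisfy the PARITY CONDITION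
`0 < τ(ξ · det H_a) ↔ 2 − p(w_τ) even` at every complex embedding `τ`.  Then there are `y ∈ M₃(L)` and hermitian `Y_a ∈ M₂(L)`, `Y_b ∈ M₁(L)` with:
`y = P (H_a⁻¹Y_a ⊕ᶠ H_b⁻¹Y_b) P⁻¹`; `y γ₀ = γ₀ y`; `y⋆ = y`; `det y = 1`; `det Y_a = ξ · det H_a`, `det Y_b = ξ⁻¹ · det H_b`; `ᵗ(σP) (H·y) P = Y_a ⊕ᶠ Y_b`;
`Y_b = ξ⁻¹ H_b`; and **`Y_a` has positive index exactly `p(w_τ)` at every `τ`** (Landherr's realisation of the invariants `(ξ det H_a ; p)`).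
This is the prescribed-signature edition of ★ `exists_commute_hermStar_eq_of_frame` required when `H` is indefinite at some real place
(Prop. 3.8.1 (d): the archimedean half of `|𝓡| = 2`). [cite: Rogawski1990, §3.8 Prop. 3.8.1 (a)(d) p. 27; §3.3 Prop. 3.3.1 p. 22]
[cite: Landherr1936HermitianForms] [cite: Deligne1982HodgeCycles, §4 Prop. 4.1 p. 44] -/
theorem exists_commute_hermStar_eq_of_frame_of_signature {H : Matrix (Fin 3) (Fin 3) L} (hH : (H.map (cmConjRingHom L))ᵀ = H) (h0 : H.det ≠ 0)
    (γ₀ : Matrix (Fin 3) (Fin 3) L) {a b : L} {P : GL (Fin 3) L} {Ha : Matrix (Fin 2) (Fin 2) L} {Hb : Matrix (Fin 1) (Fin 1) L}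
    (hP : (((P : Matrix (Fin 3) (Fin 3) L)).map (cmConjRingHom L))ᵀ * H * (P : Matrix (Fin 3) (Fin 3) L) = finSum 2 1 Ha Hb)
    (hγP : γ₀ * (P : Matrix (Fin 3) (Fin 3) L) =
      (P : Matrix (Fin 3) (Fin 3) L) * finSum 2 1 (a • (1 : Matrix (Fin 2) (Fin 2) L)) (b • (1 : Matrix (Fin 1) (Fin 1) L)))
    (hHa : (Ha.map (cmConjRingHom L))ᵀ = Ha) (hHb : (Hb.map (cmConjRingHom L))ᵀ = Hb) (hda : Ha.det ≠ 0) (hdb : Hb.det ≠ 0)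
    {ξ : L} (hξ : cmConjRingHom L ξ = ξ) (hξ0 : ξ ≠ 0) (p : InfinitePlace L → ℕ) (hp : ∀ w, p w ≤ 2)
    (hsign : ∀ τ : L →+* ℂ, 0 < (τ (ξ * Ha.det)).re ↔ Even (2 - p (InfinitePlace.mk τ))) :
    ∃ (y : Matrix (Fin 3) (Fin 3) L) (Ya : Matrix (Fin 2) (Fin 2) L) (Yb : Matrix (Fin 1) (Fin 1) L),
      y = (P : Matrix (Fin 3) (Fin 3) L) * finSum 2 1 (Ha⁻¹ * Ya) (Hb⁻¹ * Yb) * ((P⁻¹ : GL (Fin 3) L) : Matrix (Fin 3) (Fin 3) L) ∧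
      Commute y γ₀ ∧ hermStar (cmConjRingHom L) H y = y ∧ y.det = 1 ∧
      (Ya.map (cmConjRingHom L))ᵀ = Ya ∧ (Yb.map (cmConjRingHom L))ᵀ = Yb ∧ Ya.det = ξ * Ha.det ∧ Yb.det = ξ⁻¹ * Hb.det ∧
      (((P : Matrix (Fin 3) (Fin 3) L)).map (cmConjRingHom L))ᵀ * (H * y) * (P : Matrix (Fin 3) (Fin 3) L) = finSum 2 1 Ya Yb ∧
      Yb = ξ⁻¹ • Hb ∧
      ∀ (τ : L →+* ℂ) (h : (Ya.map τ).IsHermitian), (Finset.univ.filter fun i => 0 < h.eigenvalues i).card = p (InfinitePlace.mk τ) := by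
  have hξ' : IsCMField.complexConj L ξ = ξ := hξ
  have hξi : IsCMField.complexConj L ξ⁻¹ = ξ⁻¹ := by rw [map_inv₀, hξ']
  have hHal : Landherr.conjTranspose L Ha = Ha := hHa
  -- `f := ξ · det H_a ∈ L⁺ˣ`
  have hdaσ : IsCMField.complexConj L Ha.det = Ha.det := by rw [← Landherr.det_conjTranspose, hHal]
  have hf : IsCMField.complexConj L (ξ * Ha.det) = ξ * Ha.det := by rw [map_mul, hξ', hdaσ]
  have hf0 : ξ * Ha.det ≠ 0 := mul_ne_zero hξ0 hda
  -- Landherr's realisation of the invariants `(ξ det H_a ; p)` by a diagonal binary hermitian form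
  obtain ⟨d, hdσ, -, hpos, hprod⟩ := Landherr.exists_hermitianDiagonal_of_invariants L two_pos p hp hf hf0 hsign
  set Ya : Matrix (Fin 2) (Fin 2) L := Matrix.diagonal d with hYa_def
  have hYa : (Ya.map (cmConjRingHom L))ᵀ = Ya := transpose_map_diagonal_of_isReal hdσ
  have hYal : Landherr.conjTranspose L Ya = Ya := hYa
  have hdetYa : Ya.det = ξ * Ha.det := by rw [hYa_def, Matrix.det_diagonal, hprod]
  -- the rank-1 block is forced: `Y_b := ξ⁻¹ H_b`
  set Yb : Matrix (Fin 1) (Fin 1) L := ξ⁻¹ • Hb with hYb_def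
  have hYb : (Yb.map (cmConjRingHom L))ᵀ = Yb := by
    rw [hYb_def, Matrix.map_smul' _ _ _ (map_mul (cmConjRingHom L)), Matrix.transpose_smul, hHb]
    exact congrArg (· • Hb) hξi
  have hdetYb : Yb.det = ξ⁻¹ * Hb.det := by
    rw [hYb_def, Matrix.det_smul, Fintype.card_fin, pow_one]
  have hdet : Ya.det * Yb.det = Ha.det * Hb.det := by
    rw [hdetYa, hdetYb]
    calc ξ * Ha.det * (ξ⁻¹ * Hb.det) = ξ * ξ⁻¹ * (Ha.det * Hb.det) := by ring
      _ = Ha.det * Hb.det := by rw [mul_inv_cancel₀ hξ0, one_mul]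
  obtain ⟨y, hy, hcomm, hstar, hdet1, hframe⟩ := exists_commute_hermStar_eq_of_frame_blocks hH h0 γ₀ hP hγP hda hdb hYa hYb hdet
  refine ⟨y, Ya, Yb, hy, hcomm, hstar, hdet1, hYa, hYb, hdetYa, hdetYb, hframe, rfl, fun τ h => ?_⟩
  -- signatures of the diagonal `Y_a`: positive index `posCount τ d = p (w_τ)`
  have h1 : IsUnit (1 : Matrix (Fin 2) (Fin 2) L).det := by rw [Matrix.det_one]; exact isUnit_one
  have e1 : Landherr.conjTranspose L 1 * Ya * 1 = Matrix.diagonal d := by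
    rw [Landherr.conjTranspose_one, Matrix.one_mul, Matrix.mul_one]
  rw [Landherr.card_pos_eigenvalues_eq_posCount L hYal h1 e1 τ, hpos τ]

/-! ### §3 The `1 × 1` reading of the positive index -/

/-- The positive index of a `1 × 1` complex hermitian matrix is `1` if its entry is positive and `0` otherwise. [folklore: spectral theorem in rank one]
[cite: HornJohnson2013, §4.1 Thm. 4.1.5 p. 229] -/
theorem card_pos_eigenvalues_fin_one {M : Matrix (Fin 1) (Fin 1) ℂ} (h : M.IsHermitian) :
    (Finset.univ.filter fun i => 0 < h.eigenvalues i).card = if 0 < (M 0 0).re then 1 else 0 := by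
  have he : (h.eigenvalues 0 : ℂ) = M 0 0 := by
    have ht := h.trace_eq_sum_eigenvalues
    rw [Matrix.trace_fin_one, Fin.sum_univ_one] at ht
    exact ht.symm
  have he' : h.eigenvalues 0 = (M 0 0).re := by
    have := congrArg Complex.re he
    simpa using this
  by_cases hp : 0 < (M 0 0).re
  · rw [if_pos hp, Finset.filter_true_of_mem (fun i _ => by rw [Subsingleton.elim i 0, he']; exact hp), Finset.card_univ, Fintype.card_fin]
  · rw [if_neg hp, Finset.filter_false_of_mem (fun i _ => by rw [Subsingleton.elim i 0, he']; exact hp), Finset.card_empty]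

/-- The `1 × 1` block of (R6a-s′): the positive index of `τ(ξ⁻¹ H_b)` is that of `τ(H_b)` when `τ ξ > 0` and the complementary one when `τ ξ < 0`
(`H_b` hermitian non-degenerate, `ξ ∈ L⁺ˣ`). [cite: Rogawski1990, §3.8 Prop. 3.8.1 (d) p. 27] -/
theorem card_pos_eigenvalues_smul_fin_one {Hb : Matrix (Fin 1) (Fin 1) L} (hHb : (Hb.map (cmConjRingHom L))ᵀ = Hb) (hdb : Hb.det ≠ 0)
    {ξ : L} (hξ : cmConjRingHom L ξ = ξ) (hξ0 : ξ ≠ 0) (τ : L →+* ℂ) (h₁ : (Hb.map τ).IsHermitian) (h₂ : ((ξ⁻¹ • Hb).map τ).IsHermitian) :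
    (Finset.univ.filter fun i => 0 < h₂.eigenvalues i).card =
      if 0 < (τ ξ).re then (Finset.univ.filter fun i => 0 < h₁.eigenvalues i).card
      else 1 - (Finset.univ.filter fun i => 0 < h₁.eigenvalues i).card := by
  have hξ' : IsCMField.complexConj L ξ = ξ := hξ
  have hb : IsCMField.complexConj L (Hb 0 0) = Hb 0 0 := by
    have := congrFun (congrFun hHb 0) 0
    rwa [Matrix.transpose_apply, Matrix.map_apply] at this
  have hb0 : Hb 0 0 ≠ 0 := by rwa [Matrix.det_fin_one] at hdb
  -- real readings `x := Re τ ξ ≠ 0`, `c := Re τ (H_b)₀₀ ≠ 0`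
  have hξi : IsCMField.complexConj L ξ⁻¹ = ξ⁻¹ := by rw [map_inv₀, hξ']
  have hx0 : (τ ξ).re ≠ 0 := Landherr.re_ne_zero_of_isReal hξ' hξ0 τ
  have hc0 : (τ (Hb 0 0)).re ≠ 0 := Landherr.re_ne_zero_of_isReal hb hb0 τ
  rw [card_pos_eigenvalues_fin_one h₁, card_pos_eigenvalues_fin_one h₂, Matrix.map_apply, Matrix.map_apply, Matrix.smul_apply, smul_eq_mul,
    Landherr.re_mul_of_isReal hξi (Hb 0 0) τ, Landherr.re_inv_of_isReal hξ' τ]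
  rcases lt_or_gt_of_ne hx0 with hxn | hxp
  · rw [if_neg (not_lt.2 hxn.le)]
    rcases lt_or_gt_of_ne hc0 with hcn | hcp
    · rw [if_pos (mul_pos_of_neg_of_neg (inv_lt_zero.2 hxn) hcn), if_neg (not_lt.2 hcn.le)]
    · rw [if_neg (not_lt.2 (mul_neg_of_neg_of_pos (inv_lt_zero.2 hxn) hcp).le), if_pos hcp]
  · rw [if_pos hxp]
    rcases lt_or_gt_of_ne hc0 with hcn | hcp
    · rw [if_neg (not_lt.2 (mul_neg_of_pos_of_neg (inv_pos.2 hxp) hcn).le), if_neg (not_lt.2 hcn.le)]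
    · rw [if_pos (mul_pos (inv_pos.2 hxp) hcp), if_pos hcp]

/-! ### §4 (ED. 2) Signature additivity in a frame over `L`: `#pos(M_τ) = #pos(A_τ) + #pos(B_τ)` for `ᵗ(σP) M P = A ⊕ᶠ B` -/

/-- `diag d₁ ⊕ᶠ diag d₂ = diag (d₁ ⊔ d₂ ∘ e⁻¹)` in the concatenated `Fin` basis. [folklore] -/
private theorem finSum_diagonal₃ {S : Type*} [CommRing S] {N₁ N₂ : ℕ} (d₁ : Fin N₁ → S) (d₂ : Fin N₂ → S) :
    finSum N₁ N₂ (Matrix.diagonal d₁) (Matrix.diagonal d₂) = Matrix.diagonal (Sum.elim d₁ d₂ ∘ finSumFinEquiv.symm) := by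
  rw [finSum, Matrix.fromBlocks_diagonal, Matrix.reindex_apply, Matrix.submatrix_diagonal_equiv]

/-- **THE POSITIVE INDEX IS ADDITIVE IN A FRAME** (Sylvester ∕ Landherr over the CM field `L`): if `M` is hermitian and `ᵗ(σP) M P = A ⊕ᶠ B` with
`P ∈ GL` and `A`, `B` hermitian non-degenerate, then at every complex embedding `τ` the number of positive eigenvalues of `τ(M)` is that of `τ(A)`
plus that of `τ(B)` (diagonalise the blocks, ★ `Landherr.exists_congr_diagonal`, and read all three through the common diagonaliser
`P · (G_A ⊕ᶠ G_B)`, ★ `Landherr.card_pos_eigenvalues_eq_posCount`). [cite: Landherr1936HermitianForms] [cite: HornJohnson2013, §4.5 Thm. 4.5.8 p. 282] -/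
theorem card_pos_eigenvalues_eq_add_of_frame {N₁ N₂ : ℕ} {M : Matrix (Fin (N₁ + N₂)) (Fin (N₁ + N₂)) L}
    (hM : (M.map (cmConjRingHom L))ᵀ = M) (P : GL (Fin (N₁ + N₂)) L) {A : Matrix (Fin N₁) (Fin N₁) L} {B : Matrix (Fin N₂) (Fin N₂) L}
    (hA : (A.map (cmConjRingHom L))ᵀ = A) (hB : (B.map (cmConjRingHom L))ᵀ = B) (hA0 : A.det ≠ 0) (hB0 : B.det ≠ 0)
    (hP : (((P : Matrix (Fin (N₁ + N₂)) (Fin (N₁ + N₂)) L)).map (cmConjRingHom L))ᵀ * M * (P : Matrix (Fin (N₁ + N₂)) (Fin (N₁ + N₂)) L) =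
      finSum N₁ N₂ A B)
    (τ : L →+* ℂ) (h : (M.map τ).IsHermitian) (h₁ : (A.map τ).IsHermitian) (h₂ : (B.map τ).IsHermitian) :
    (Finset.univ.filter fun i => 0 < h.eigenvalues i).card =
      (Finset.univ.filter fun i => 0 < h₁.eigenvalues i).card + (Finset.univ.filter fun i => 0 < h₂.eigenvalues i).card := by
  have hMl : Landherr.conjTranspose L M = M := hM
  have hAl : Landherr.conjTranspose L A = A := hA
  have hBl : Landherr.conjTranspose L B = B := hB
  obtain ⟨Ga, hGa, da, -, -, ea⟩ := Landherr.exists_congr_diagonal L A hAl hA0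
  obtain ⟨Gb, hGb, db, -, -, eb⟩ := Landherr.exists_congr_diagonal L B hBl hB0
  set Q : Matrix (Fin (N₁ + N₂)) (Fin (N₁ + N₂)) L := (P : Matrix (Fin (N₁ + N₂)) (Fin (N₁ + N₂)) L) with hQ
  -- the common diagonaliser `G₃ := P · (G_A ⊕ᶠ G_B)`
  set G₃ : Matrix (Fin (N₁ + N₂)) (Fin (N₁ + N₂)) L := Q * finSum N₁ N₂ Ga Gb with hG₃_def
  have hG₃ : IsUnit G₃.det := by
    rw [hG₃_def, Matrix.det_mul, det_finSum₃]
    exact (Matrix.isUnits_det_units P).mul (hGa.mul hGb)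
  have hG₃s : Landherr.conjTranspose L G₃ =
      finSum N₁ N₂ (Landherr.conjTranspose L Ga) (Landherr.conjTranspose L Gb) * (Q.map (cmConjRingHom L))ᵀ := by
    rw [hG₃_def, Landherr.conjTranspose_mul, landherr_conjTranspose_eq L (finSum N₁ N₂ Ga Gb), finSum_conjTranspose₃]
    rfl
  have e₃ : Landherr.conjTranspose L G₃ * M * G₃ = Matrix.diagonal (Sum.elim da db ∘ finSumFinEquiv.symm) := by
    rw [hG₃s, hG₃_def]
    calc finSum N₁ N₂ (Landherr.conjTranspose L Ga) (Landherr.conjTranspose L Gb) * (Q.map (cmConjRingHom L))ᵀ * M * (Q * finSum N₁ N₂ Ga Gb)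
        = finSum N₁ N₂ (Landherr.conjTranspose L Ga) (Landherr.conjTranspose L Gb) * ((Q.map (cmConjRingHom L))ᵀ * M * Q) *
            finSum N₁ N₂ Ga Gb := by
          simp only [Matrix.mul_assoc]
      _ = Matrix.diagonal (Sum.elim da db ∘ finSumFinEquiv.symm) := by
          rw [hP, finSum_mul_finSum₃, finSum_mul_finSum₃, ea, eb, finSum_diagonal₃]
  rw [Landherr.card_pos_eigenvalues_eq_posCount L hMl hG₃ e₃ τ, Landherr.card_pos_eigenvalues_eq_posCount L hAl hGa ea τ,
    Landherr.card_pos_eigenvalues_eq_posCount L hBl hGb eb τ, Landherr.posCount_comp_equiv, Landherr.posCount_sum_elim]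

/-- The singular plane-first frame of `H`: **`#pos τ(H) = #pos τ(H_a) + [0 < τ(H_b)₀₀]`** for `ᵗ(σP) H P = H_a ⊕ᶠ H_b`. [cite: Rogawski1990, §3.8 Prop. 3.8.1 (d) p. 27]
[cite: Landherr1936HermitianForms] -/
theorem card_pos_eigenvalues_eq_of_frame_fin_one {H : Matrix (Fin 3) (Fin 3) L} (hH : (H.map (cmConjRingHom L))ᵀ = H) (P : GL (Fin 3) L)
    {Ha : Matrix (Fin 2) (Fin 2) L} {Hb : Matrix (Fin 1) (Fin 1) L} (hHa : (Ha.map (cmConjRingHom L))ᵀ = Ha) (hHb : (Hb.map (cmConjRingHom L))ᵀ = Hb)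
    (hda : Ha.det ≠ 0) (hdb : Hb.det ≠ 0)
    (hP : (((P : Matrix (Fin 3) (Fin 3) L)).map (cmConjRingHom L))ᵀ * H * (P : Matrix (Fin 3) (Fin 3) L) = finSum 2 1 Ha Hb)
    (τ : L →+* ℂ) (h : (H.map τ).IsHermitian) (h₁ : (Ha.map τ).IsHermitian) :
    (Finset.univ.filter fun i => 0 < h.eigenvalues i).card =
      (Finset.univ.filter fun i => 0 < h₁.eigenvalues i).card + (if 0 < (τ (Hb 0 0)).re then 1 else 0) := by
  have hHbl : Landherr.conjTranspose L Hb = Hb := hHb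
  rw [card_pos_eigenvalues_eq_add_of_frame (N₁ := 2) (N₂ := 1) hH P hHa hHb hda hdb hP τ h h₁ (Landherr.isHermitian_map L hHbl τ),
    card_pos_eigenvalues_fin_one, Matrix.map_apply]

/-! ### §5 (ED. 2) The TOTAL signature of `H · y` in (R6a-s′), and clause 5 of ★ P5″ `hreal` verbatim -/

/-- **(R6a-s′) WITH THE TOTAL SIGNATURE OF `H·y`**: everything of `exists_commute_hermStar_eq_of_frame_of_signature`, plus — at every complex
embedding `τ` — `#pos τ(H·y) = p(w_τ) + [0 < τ(ξ⁻¹ (H_b)₀₀)]` (§4 additivity on the frame `ᵗ(σP) (H·y) P = Y_a ⊕ᶠ ξ⁻¹H_b`).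
[cite: Rogawski1990, §3.8 Prop. 3.8.1 (a)(d) p. 27; §3.3 Prop. 3.3.1 p. 22] [cite: Landherr1936HermitianForms] [cite: Deligne1982HodgeCycles, §4 Prop. 4.1 p. 44] -/
theorem exists_commute_hermStar_eq_of_frame_of_signature_total {H : Matrix (Fin 3) (Fin 3) L} (hH : (H.map (cmConjRingHom L))ᵀ = H)
    (h0 : H.det ≠ 0) (γ₀ : Matrix (Fin 3) (Fin 3) L) {a b : L} {P : GL (Fin 3) L} {Ha : Matrix (Fin 2) (Fin 2) L} {Hb : Matrix (Fin 1) (Fin 1) L}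
    (hP : (((P : Matrix (Fin 3) (Fin 3) L)).map (cmConjRingHom L))ᵀ * H * (P : Matrix (Fin 3) (Fin 3) L) = finSum 2 1 Ha Hb)
    (hγP : γ₀ * (P : Matrix (Fin 3) (Fin 3) L) =
      (P : Matrix (Fin 3) (Fin 3) L) * finSum 2 1 (a • (1 : Matrix (Fin 2) (Fin 2) L)) (b • (1 : Matrix (Fin 1) (Fin 1) L)))
    (hHa : (Ha.map (cmConjRingHom L))ᵀ = Ha) (hHb : (Hb.map (cmConjRingHom L))ᵀ = Hb) (hda : Ha.det ≠ 0) (hdb : Hb.det ≠ 0)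
    {ξ : L} (hξ : cmConjRingHom L ξ = ξ) (hξ0 : ξ ≠ 0) (p : InfinitePlace L → ℕ) (hp : ∀ w, p w ≤ 2)
    (hsign : ∀ τ : L →+* ℂ, 0 < (τ (ξ * Ha.det)).re ↔ Even (2 - p (InfinitePlace.mk τ))) :
    ∃ (y : Matrix (Fin 3) (Fin 3) L) (Ya : Matrix (Fin 2) (Fin 2) L) (Yb : Matrix (Fin 1) (Fin 1) L),
      y = (P : Matrix (Fin 3) (Fin 3) L) * finSum 2 1 (Ha⁻¹ * Ya) (Hb⁻¹ * Yb) * ((P⁻¹ : GL (Fin 3) L) : Matrix (Fin 3) (Fin 3) L) ∧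
      Commute y γ₀ ∧ hermStar (cmConjRingHom L) H y = y ∧ y.det = 1 ∧
      (Ya.map (cmConjRingHom L))ᵀ = Ya ∧ (Yb.map (cmConjRingHom L))ᵀ = Yb ∧ Ya.det = ξ * Ha.det ∧ Yb.det = ξ⁻¹ * Hb.det ∧
      (((P : Matrix (Fin 3) (Fin 3) L)).map (cmConjRingHom L))ᵀ * (H * y) * (P : Matrix (Fin 3) (Fin 3) L) = finSum 2 1 Ya Yb ∧
      Yb = ξ⁻¹ • Hb ∧
      (∀ (τ : L →+* ℂ) (h : (Ya.map τ).IsHermitian), (Finset.univ.filter fun i => 0 < h.eigenvalues i).card = p (InfinitePlace.mk τ)) ∧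
      ((H * y).map (cmConjRingHom L))ᵀ = H * y ∧
      ∀ (τ : L →+* ℂ) (h₂ : ((H * y).map τ).IsHermitian),
        (Finset.univ.filter fun i => 0 < h₂.eigenvalues i).card = p (InfinitePlace.mk τ) + (if 0 < (τ (ξ⁻¹ * Hb 0 0)).re then 1 else 0) := by
  obtain ⟨y, Ya, Yb, hy, hcomm, hstar, hdet1, hYah, hYbh, hYa, hYb, hyP, hYbξ, hpYa⟩ :=
    exists_commute_hermStar_eq_of_frame_of_signature hH h0 γ₀ hP hγP hHa hHb hda hdb hξ hξ0 p hp hsign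
  -- `H · y` is hermitian: its frame congruent `Y_a ⊕ᶠ Y_b` is
  have hHy : ((H * y).map (cmConjRingHom L))ᵀ = H * y := by
    refine hermitian_of_congr_hermitian P ?_
    rw [hyP, finSum_conjTranspose₃, hYah, hYbh]
  have hYa0 : Ya.det ≠ 0 := by rw [hYa]; exact mul_ne_zero hξ0 hda
  have hYb0 : Yb.det ≠ 0 := by rw [hYb]; exact mul_ne_zero (inv_ne_zero hξ0) hdb
  have hYal : Landherr.conjTranspose L Ya = Ya := hYah
  have hYbl : Landherr.conjTranspose L Yb = Yb := hYbh
  refine ⟨y, Ya, Yb, hy, hcomm, hstar, hdet1, hYah, hYbh, hYa, hYb, hyP, hYbξ, hpYa, hHy, fun τ h₂ => ?_⟩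
  rw [card_pos_eigenvalues_eq_add_of_frame (N₁ := 2) (N₂ := 1) hHy P hYah hYbh hYa0 hYb0 hyP τ h₂ (Landherr.isHermitian_map L hYal τ)
    (Landherr.isHermitian_map L hYbl τ), hpYa τ, card_pos_eigenvalues_fin_one, Matrix.map_apply, hYbξ, Matrix.smul_apply, smul_eq_mul]

/-- **(R6a-s′) IN CLAUSE-5 LETTERS OF ★ P5″ `hreal`**: if the prescribed data also account for the signature of `H` itself —
`#pos τ(H) = p(w_τ) + [0 < τ(ξ⁻¹ (H_b)₀₀)]` at every `τ` (in (h5): `p w :=` the positive index of the `a`-block of `H_{g,w}`, whose total index is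
that of `H_w`) — then the unit `y` of (R6a-s′) satisfies clause 5 VERBATIM: `∀ ρ h₁ h₂, #pos ρ(H) = #pos ρ(H·y)`.
[cite: Rogawski1990, §3.8 Prop. 3.8.1 (a)(d) p. 27; §3.3 Prop. 3.3.1 p. 22] [cite: Landherr1936HermitianForms] -/
theorem exists_commute_hermStar_eq_of_frame_of_signature_clause5 {H : Matrix (Fin 3) (Fin 3) L} (hH : (H.map (cmConjRingHom L))ᵀ = H)
    (h0 : H.det ≠ 0) (γ₀ : Matrix (Fin 3) (Fin 3) L) {a b : L} {P : GL (Fin 3) L} {Ha : Matrix (Fin 2) (Fin 2) L} {Hb : Matrix (Fin 1) (Fin 1) L}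
    (hP : (((P : Matrix (Fin 3) (Fin 3) L)).map (cmConjRingHom L))ᵀ * H * (P : Matrix (Fin 3) (Fin 3) L) = finSum 2 1 Ha Hb)
    (hγP : γ₀ * (P : Matrix (Fin 3) (Fin 3) L) =
      (P : Matrix (Fin 3) (Fin 3) L) * finSum 2 1 (a • (1 : Matrix (Fin 2) (Fin 2) L)) (b • (1 : Matrix (Fin 1) (Fin 1) L)))
    (hHa : (Ha.map (cmConjRingHom L))ᵀ = Ha) (hHb : (Hb.map (cmConjRingHom L))ᵀ = Hb) (hda : Ha.det ≠ 0) (hdb : Hb.det ≠ 0)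
    {ξ : L} (hξ : cmConjRingHom L ξ = ξ) (hξ0 : ξ ≠ 0) (p : InfinitePlace L → ℕ) (hp : ∀ w, p w ≤ 2)
    (hsign : ∀ τ : L →+* ℂ, 0 < (τ (ξ * Ha.det)).re ↔ Even (2 - p (InfinitePlace.mk τ)))
    (htot : ∀ (τ : L →+* ℂ) (h₁ : (H.map τ).IsHermitian),
      (Finset.univ.filter fun i => 0 < h₁.eigenvalues i).card = p (InfinitePlace.mk τ) + (if 0 < (τ (ξ⁻¹ * Hb 0 0)).re then 1 else 0)) :
    ∃ (y : Matrix (Fin 3) (Fin 3) L) (Ya : Matrix (Fin 2) (Fin 2) L) (Yb : Matrix (Fin 1) (Fin 1) L),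
      y = (P : Matrix (Fin 3) (Fin 3) L) * finSum 2 1 (Ha⁻¹ * Ya) (Hb⁻¹ * Yb) * ((P⁻¹ : GL (Fin 3) L) : Matrix (Fin 3) (Fin 3) L) ∧
      Commute y γ₀ ∧ hermStar (cmConjRingHom L) H y = y ∧ y.det = 1 ∧
      (Ya.map (cmConjRingHom L))ᵀ = Ya ∧ (Yb.map (cmConjRingHom L))ᵀ = Yb ∧ Ya.det = ξ * Ha.det ∧ Yb.det = ξ⁻¹ * Hb.det ∧
      (((P : Matrix (Fin 3) (Fin 3) L)).map (cmConjRingHom L))ᵀ * (H * y) * (P : Matrix (Fin 3) (Fin 3) L) = finSum 2 1 Ya Yb ∧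
      Yb = ξ⁻¹ • Hb ∧
      (∀ (τ : L →+* ℂ) (h : (Ya.map τ).IsHermitian), (Finset.univ.filter fun i => 0 < h.eigenvalues i).card = p (InfinitePlace.mk τ)) ∧
      ∀ (ρ : L →+* ℂ) (h₁ : (H.map ρ).IsHermitian) (h₂ : ((H * y).map ρ).IsHermitian),
        (Finset.univ.filter fun i => 0 < h₁.eigenvalues i).card = (Finset.univ.filter fun i => 0 < h₂.eigenvalues i).card := by
  obtain ⟨y, Ya, Yb, hy, hcomm, hstar, hdet1, hYah, hYbh, hYa, hYb, hyP, hYbξ, hpYa, -, htotal⟩ :=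
    exists_commute_hermStar_eq_of_frame_of_signature_total hH h0 γ₀ hP hγP hHa hHb hda hdb hξ hξ0 p hp hsign
  exact ⟨y, Ya, Yb, hy, hcomm, hstar, hdet1, hYah, hYbh, hYa, hYb, hyP, hYbξ, hpYa, fun ρ h₁ h₂ => by rw [htot ρ h₁, htotal ρ h₂]⟩

end Frame

end Literature.NumberTheory.Rogawski1990

end
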